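import Mathlib
import Literature.Computability.AlgebraicComplexity.ValiantClasses
import Literature.Computability.AlgebraicComplexity.ArithCircuit
import Literature.Computability.AlgebraicComplexity.SOSDecomposition
import Literature.Computability.AlgebraicComplexity.ValiantCriterion
import Literature.Computability.Complexity.CircuitComposition
import Summits.ValiantsHypothesis.ValiantsHypothesis.Theses.FeketeSOS

/-!
# Sketch (crux-ideate, ideator 3) for crux `FeketeSOS.SOSMagnification` (stmt-ValiantsHypothesis-3995)

First-lemma signatures for three idea cards; proofs are `sorry` (sketch only, my folder).
-/

noncomputable section

open MvPolynomial Finset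
open Literature.Computability.AlgebraicComplexity

namespace Summit.ValiantsHypothesis.ValiantsHypothesis.Cruxes.SOSMagnification.SketchIdeator3

/-! ## Common objects: the base-`k` one-hot digit lift of `F_p` and the Kronecker substitution -/

/-- the `j`-th base-`k` digit of `m`, as an element of `Fin k` -/
def digit (k : ℕ) [NeZero k] (m j : ℕ) : Fin k :=
  ⟨(m / k ^ j) % k, Nat.mod_lt _ (Nat.pos_of_neZero k)⟩

/-- DST's multilinear Kronecker lift `P_{k,n} = φ^{lin}_{k,n}(F_p)`: the one-hot digit family
`Fek_{k,p,n}(y) = Σ_{m<p} (m|p) · Π_{j<n} y_{j, digit_j(m)}` in the `k·n` variables `y_{j,ℓ}`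
(homogeneous of degree `n`, set-multilinear in the blocks `j`). -/
def fekDigit (k : ℕ) [NeZero k] (p : ℕ) [Fact p.Prime] (n : ℕ) : MvPolynomial (Fin n × Fin k) ℂ :=
  ∑ m ∈ range p, C (((legendreSym p m : ℤ)) : ℂ) * ∏ j : Fin n, X (j, digit k m j)

/-- the inverse (multilinear) Kronecker substitution `ψ^{lin}_{k,n} : y_{j,ℓ} ↦ x^{ℓ k^j}` -/
def kron (k n : ℕ) : Fin n × Fin k → Polynomial ℂ :=
  fun v => (Polynomial.X : Polynomial ℂ) ^ ((v.2 : ℕ) * k ^ (v.1 : ℕ))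

/-- the Fekete polynomial exactly as inlined in the route items -/
def feketePoly (p : ℕ) [Fact p.Prime] : Polynomial ℂ :=
  ∑ m ∈ range p, Polynomial.C ((legendreSym p m : ℤ) : ℂ) * Polynomial.X ^ m

/-- faithfulness of the lift: `ψ(Fek_{k,p,n}) = F_p` as soon as `p ≤ k^n` (digits do not wrap). -/
theorem aeval_kron_fekDigit (k : ℕ) [NeZero k] (p : ℕ) [Fact p.Prime] (n : ℕ) (hk : 2 ≤ k) (hp : p ≤ k ^ n) :
    MvPolynomial.aeval (kron k n) (fekDigit k p n) = feketePoly p := by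
  sorry

/-! ## Card A — additive-character (Gauss–Euler) Boolean-sum witness: `Fek ∈ VNP_ℂ` with no Boolean circuits

First lemma (scalar heart, PROVED below): counting square roots with the additive characters of
`ℤ/p`, `(m|p) = (1/p) Σ_{x<p} Σ_{t<p} ω^{t (x² + (p-1) m)} − 1` for `0 ≤ m < p`, `ω` a primitive
`p`-th root of unity (Mathlib: `quadraticChar_card_sqrts`, `geom_sum_eq`,
`IsPrimitiveRoot.dvd_of_pow_eq_one`; instantiate `ω := Complex.exp (2πi/p)` by
`Complex.isPrimitiveRoot_exp`). -/

/-- orthogonality of the additive characters of `ℤ/p` along `range p` -/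
theorem charSum_inner (p : ℕ) [Fact p.Prime] {ω : ℂ} (hω : IsPrimitiveRoot ω p) (y : ℕ) :
    ∑ t ∈ range p, ω ^ (t * y) = if p ∣ y then (p : ℂ) else 0 := by
  by_cases h : p ∣ y
  · rw [if_pos h]
    have h1 : ω ^ y = 1 := by
      obtain ⟨c, rfl⟩ := h
      rw [pow_mul, hω.pow_eq_one, one_pow]
    simp_rw [mul_comm _ y, pow_mul, h1, one_pow]
    simp
  · rw [if_neg h]
    have hne : ω ^ y ≠ 1 := fun h1 => h (hω.dvd_of_pow_eq_one y h1)
    simp_rw [mul_comm _ y, pow_mul]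
    rw [geom_sum_eq hne, ← pow_mul, mul_comm, pow_mul, hω.pow_eq_one, one_pow, sub_self, zero_div]

/-- the `x < p` with `p ∣ x² + (p-1)·m` are in bijection with the square roots of `m` in `ZMod p` -/
theorem card_filter_range_eq_card_sqrts (p : ℕ) [hp : Fact p.Prime] (m : ℕ) :
    ((range p).filter fun x => p ∣ x ^ 2 + (p - 1) * m).card =
      (univ.filter fun x : ZMod p => x ^ 2 = (m : ZMod p)).card := by
  classical
  haveI : NeZero p := ⟨hp.out.ne_zero⟩
  have hpm1 : ((p - 1 : ℕ) : ZMod p) = -1 := by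
    rw [Nat.cast_sub hp.out.one_le, ZMod.natCast_self, Nat.cast_one, zero_sub]
  refine Finset.card_bij (fun x _ => (x : ZMod p)) ?_ ?_ ?_
  · intro x hx
    simp only [mem_filter, mem_range] at hx
    simp only [mem_filter, mem_univ, true_and]
    have h2 : ((x ^ 2 + (p - 1) * m : ℕ) : ZMod p) = 0 := (ZMod.natCast_eq_zero_iff _ _).2 hx.2
    push_cast at h2
    rw [hpm1] at h2
    linear_combination h2
  · intro x hx y hy hxy
    simp only [mem_filter, mem_range] at hx hy
    have := congrArg ZMod.val hxy
    rwa [ZMod.val_natCast, ZMod.val_natCast, Nat.mod_eq_of_lt hx.1, Nat.mod_eq_of_lt hy.1] at this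
  · intro z hz
    simp only [mem_filter, mem_univ, true_and] at hz
    refine ⟨z.val, ?_, ZMod.natCast_zmod_val z⟩
    simp only [mem_filter, mem_range]
    refine ⟨ZMod.val_lt z, ?_⟩
    rw [← ZMod.natCast_eq_zero_iff]
    push_cast
    rw [hpm1, ZMod.natCast_zmod_val, hz]
    ring

/-- **Card A, first lemma — PROVED.** Counting square roots with additive characters. -/
theorem legendreSym_eq_charSum (p : ℕ) [hp : Fact p.Prime] (hp2 : p ≠ 2) {ω : ℂ} (hω : IsPrimitiveRoot ω p)
    (m : ℕ) (_hm : m < p) :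
    ((legendreSym p m : ℤ) : ℂ) =
      (1 / (p : ℂ)) * (∑ x ∈ range p, ∑ t ∈ range p, ω ^ (t * (x ^ 2 + (p - 1) * m))) - 1 := by
  classical
  have hp0 : (p : ℂ) ≠ 0 := Nat.cast_ne_zero.2 hp.out.ne_zero
  simp_rw [charSum_inner p hω]
  rw [Finset.sum_ite, Finset.sum_const_zero, add_zero, Finset.sum_const, nsmul_eq_mul,
    card_filter_range_eq_card_sqrts p m]
  have hchar : ringChar (ZMod p) ≠ 2 := by rwa [ZMod.ringChar_zmod_n]
  have hsq := quadraticChar_card_sqrts hchar (m : ZMod p)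
  have hset : (univ.filter fun x : ZMod p => x ^ 2 = (m : ZMod p)) =
      {x : ZMod p | x ^ 2 = (m : ZMod p)}.toFinset := by
    ext x; simp
  rw [hset]
  have hleg : (legendreSym p m : ℤ) = quadraticChar (ZMod p) (m : ZMod p) := by
    simp [legendreSym]
  rw [hleg]
  have hcardZ : (({x : ZMod p | x ^ 2 = (m : ZMod p)}.toFinset.card : ℕ) : ℂ) =
      ((quadraticChar (ZMod p) (m : ZMod p) : ℤ) : ℂ) + 1 := by
    have := congrArg (fun z : ℤ => (z : ℂ)) hsq
    push_cast at this ⊢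
    exact this
  rw [hcardZ]
  field_simp
  ring

/-- Card A, family form: an explicit product-form witness `g_n` in the digit variables plus
`2N` Boolean variables (`x`-bits and `t`-bits, `p ≤ 2^N`) with `boolSum g_n = Fek_{k,p,n}`,
polynomial complexity and degree (constants: `ω^{2^a}`, `1/p`; shape
`(1/p)·[x<p]·[t<p]·Π_{u,i,i'}(1 + t_u x_i x_{i'}(ω^{2^{u+i+i'}}−1))·D_t(y) − [x=t=0]·D_0(y)` with
`D_t(y) = Σ_{m<p} ω^{(p-1) t m} Π_j y_{j,m_j}` realised by the digit-serial comparison automaton). -/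
theorem exists_boolSum_witness_fekDigit :
    ∃ c : ℕ, ∀ (k : ℕ) [NeZero k] (p : ℕ) [Fact p.Prime] (n N : ℕ), p ≠ 2 → p ≤ 2 ^ N → p ≤ k ^ n →
      ∃ g : MvPolynomial ((Fin n × Fin k) ⊕ Fin (N + N)) ℂ,
        boolSum g = fekDigit k p n ∧
        complexity g ≤ c * (N + k * n + 1) ^ 3 ∧
        g.totalDegree ≤ c * (N + n + 1) ^ 3 := by
  sorry

/-- Card A, conclusion of the line's distinctive stub: the digit family is p-definable over `ℂ`
for any prime selector `p_n ≤ k^n` (nonuniformity is native: `p_n`, `ω_{p_n}`, `1/p_n` are constants). -/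
theorem isVNPFamily_fekDigit (k : ℕ) [NeZero k] (hk : 2 ≤ k) (pSel : ℕ → ℕ)
    [hprime : ∀ n, Fact (pSel n).Prime] (hodd : ∀ n, pSel n ≠ 2) (hle : ∀ n, 1 ≤ n → pSel n ≤ k ^ n) :
    IsVNPFamily (k := ℂ) (σ := fun n => Fin n × Fin k) (fun n => fekDigit k (pSel n) n) := by
  sorry

/-! ## Card B — nondeterministic square root + projection to `(1, −1)`: Valiant's criterion on a RELATION

First lemma (the projection identity, pure algebra over any commutative ring): for a Boolean
relation `Q(d, w, σ)` on digit bits `d`, witness bits `w` and one sign bit `σ`, substituting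
`W := 1`, `S := −1` in `circuitSum`-shaped sums turns acceptance counts into the GapP-style
signed count `#{w : Q(d,w,0)} − #{w : Q(d,w,1)}` as the coefficient of `y^d`. -/
theorem aeval_signProjection_boolIndicatorSum {R : Type*} [CommRing R] {D Wn : ℕ}
    (Q : ((Fin D ⊕ Fin Wn) ⊕ Unit → Bool) → Bool) :
    MvPolynomial.aeval
        (Sum.elim (Sum.elim (fun i : Fin D => (X i : MvPolynomial (Fin D) R)) (fun _ : Fin Wn => 1))
          (fun _ : Unit => (-1 : MvPolynomial (Fin D) R)))
        (∑ e : (Fin D ⊕ Fin Wn) ⊕ Unit → Bool,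
          C (if Q e then (1 : R) else 0) * ∏ v, (if e v then X v else 1)) =
      ∑ d : Fin D → Bool,
        C (((Finset.univ.filter fun w : Fin Wn → Bool =>
                Q (Sum.elim (Sum.elim d w) fun _ => false) = true).card : R) -
            ((Finset.univ.filter fun w : Fin Wn → Bool =>
                Q (Sum.elim (Sum.elim d w) fun _ => true) = true).card : R)) *
          ∏ i : Fin D, (if d i then X i else 1) := by
  sorry

/-- the integer value encoded by one-hot digit bits (junk on invalid patterns) -/
def digitVal (k n : ℕ) (d : Fin n × Fin k → Bool) : ℕ :=
  ∑ j : Fin n, ∑ ℓ : Fin k, if d (j, ℓ) then (ℓ : ℕ) * k ^ (j : ℕ) else 0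

open Classical in
/-- Card B, the only Boolean content: ONE modular squaring, verified (not computed) — the relation
`valid(d) ∧ val(d) < p ∧ (σ = 0 ∧ w < p ∧ p ∣ w² + (p−1)·val(d)) ∨ (σ = 1 ∧ w = 0)` has
`B₂`-circuits of size `poly(kn + N)` (tree: `cktSize_testBits_aeval_eval` on the 3-gate integer
circuit `W·W + (p−1)·V`, plus comparators). -/
theorem cktSize_sqrtRelation :
    ∃ c : ℕ, ∀ (k n p N : ℕ), 2 ≤ k → p.Prime → p ≤ 2 ^ N →
      Literature.Computability.Complexity.CktSize Literature.Computability.Complexity.B2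
        (fun (e : ((Fin n × Fin k) ⊕ Fin N) ⊕ Unit → Bool) (_ : Unit) =>
          decide ((∀ j : Fin n, ∃! ℓ : Fin k, e (Sum.inl (Sum.inl (j, ℓ))) = true) ∧
            digitVal k n (fun v => e (Sum.inl (Sum.inl v))) < p ∧
            ((e (Sum.inr ()) = false ∧ Nat.ofBits (fun i : Fin N => e (Sum.inl (Sum.inr i))) < p ∧
                p ∣ Nat.ofBits (fun i : Fin N => e (Sum.inl (Sum.inr i))) ^ 2 +
                  (p - 1) * digitVal k n (fun v => e (Sum.inl (Sum.inl v)))) ∨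
             (e (Sum.inr ()) = true ∧ ∀ i : Fin N, e (Sum.inl (Sum.inr i)) = false))))
        (c * (k * n + N + 1) ^ 3) := by
  sorry

/-! ## Card C — cut at the family: the unconditional univariate SOS-from-digit-circuit lemma
(DST Lemma 3.1 ∘ ψ^{lin}, Remark 2 and eq. (8) in the tree's typing; in-tree ingredients
`DuttaSaxenaThierauf2024_sosDecomposition_holds`, `card_support_aeval_le_of_isTerm`,
`card_monomials_degree`/`multichoose_eq_card_degreeMonomials`). -/
theorem univariateSOS_of_digitCircuit (k n s : ℕ) (hk : 2 ≤ k) (hn : 1 ≤ n)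
    (P : MvPolynomial (Fin n × Fin k) ℂ) (hP : complexity P ≤ s) (hdeg : P.totalDegree ≤ n) :
    ∃ (s' : ℕ) (a : Fin s' → ℂ) (g : Fin s' → Polynomial ℂ),
      s' ≤ (s * n + 2) ^ (8 * (Nat.log 2 n + 1)) ∧
      (∀ i, (g i).natDegree ≤ ((n + 1) / 2) * (k - 1) * k ^ (n - 1)) ∧
      (∀ i, (g i).support.card ≤ (k * n + (n + 1) / 2).choose ((n + 1) / 2)) ∧
      (∑ i, Polynomial.C (a i) * g i ^ 2) = MvPolynomial.aeval (kron k n) P := by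
  sorry

/-- Card C, the family cut: SOS-hardness of `F_p` (route hypothesis, verbatim) is a `VP`-LOWER
bound for the digit family — no `VNP` anywhere in this half. -/
theorem not_isVPFamily_fekDigit_of_feketeSOSHard
    (h : Summit.ValiantsHypothesis.ValiantsHypothesis.Theses.FeketeSOS.FeketeSOSHard) :
    ∃ k₀ : ℕ, ∀ (k : ℕ) [NeZero k], k₀ ≤ k → ∀ (pSel : ℕ → ℕ) [∀ n, Fact (pSel n).Prime],
      (∀ n, 1 ≤ n → pSel n ≤ k ^ n) → (∀ n, 1 ≤ n → k ^ n < 2 * pSel n) →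
      ¬ IsVPFamily (k := ℂ) (σ := fun n => Fin n × Fin k) (fun n => fekDigit k (pSel n) n) := by
  sorry

/-- The composition both A and B feed (with C): `Fek ∈ VNP`, `Fek ∉ VP` ⇒ the crux, by name. -/
theorem SOSMagnification_of
    (hVNP : ∀ (k : ℕ) [NeZero k], 2 ≤ k → ∀ (pSel : ℕ → ℕ) [∀ n, Fact (pSel n).Prime], (∀ n, pSel n ≠ 2) →
      (∀ n, 1 ≤ n → pSel n ≤ k ^ n) →
      IsVNPFamily (k := ℂ) (σ := fun n => Fin n × Fin k) (fun n => fekDigit k (pSel n) n))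
    (hLow : Summit.ValiantsHypothesis.ValiantsHypothesis.Theses.FeketeSOS.FeketeSOSHard →
      ∃ k₀ : ℕ, ∀ (k : ℕ) [NeZero k], k₀ ≤ k → ∀ (pSel : ℕ → ℕ) [∀ n, Fact (pSel n).Prime],
        (∀ n, 1 ≤ n → pSel n ≤ k ^ n) → (∀ n, 1 ≤ n → k ^ n < 2 * pSel n) →
        ¬ IsVPFamily (k := ℂ) (σ := fun n => Fin n × Fin k) (fun n => fekDigit k (pSel n) n)) :
    Summit.ValiantsHypothesis.ValiantsHypothesis.Theses.FeketeSOS.SOSMagnification := by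
  intro hHard
  show Literature.Computability.AlgebraicComplexity.VP ℂ ≠ Literature.Computability.AlgebraicComplexity.VNP ℂ
  intro hEq
  obtain ⟨k₀, hk₀⟩ := hLow hHard
  obtain ⟨k, hk0, hk4⟩ : ∃ k : ℕ, k₀ ≤ k ∧ 4 ≤ k := ⟨max k₀ 4, le_max_left _ _, le_max_right _ _⟩
  haveI : NeZero k := ⟨by omega⟩
  -- an odd prime selector with k^n/2 < p_n ≤ k^n (Bertrand), p_0 := 3
  have hsel : ∀ n : ℕ, ∃ p : ℕ, p.Prime ∧ p ≠ 2 ∧ (1 ≤ n → p ≤ k ^ n) ∧ (1 ≤ n → k ^ n < 2 * p) := by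
    intro n
    rcases Nat.eq_zero_or_pos n with rfl | hn
    · exact ⟨3, Nat.prime_three, by norm_num, fun h => absurd h (by norm_num),
        fun h => absurd h (by norm_num)⟩
    · have hkn : 4 ≤ k ^ n :=
        calc 4 ≤ k := hk4
          _ = k ^ 1 := (pow_one k).symm
          _ ≤ k ^ n := Nat.pow_le_pow_right (by omega) hn
      obtain ⟨p, hp, hlt, hle⟩ := Nat.exists_prime_lt_and_le_two_mul (k ^ n / 2) (by omega)
      exact ⟨p, hp, by omega, fun _ => by omega, fun _ => by omega⟩
  choose pSel hpP hp2 hple hpbig using hsel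
  haveI : ∀ n, Fact (pSel n).Prime := fun n => ⟨hpP n⟩
  have h1 : IsVNPFamily (k := ℂ) (σ := fun n => Fin n × Fin k) (fun n => fekDigit k (pSel n) n) :=
    hVNP k (by omega) pSel hp2 hple
  have h2 := hk₀ k hk0 pSel hple hpbig
  apply h2
  have hmem : PolyFamily.ofFintype (fun n => fekDigit k (pSel n) n) ∈
      Literature.Computability.AlgebraicComplexity.VNP ℂ :=
    (mem_VNP_ofFintype_iff_holds (k := ℂ) (σ := fun n => Fin n × Fin k)
      (fun n => fekDigit k (pSel n) n)).2 h1
  rw [← hEq] at hmem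
  exact (mem_VP_ofFintype_iff_holds (k := ℂ) (σ := fun n => Fin n × Fin k)
    (fun n => fekDigit k (pSel n) n)).1 hmem

end Summit.ValiantsHypothesis.ValiantsHypothesis.Cruxes.SOSMagnification.SketchIdeator3
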